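import Literature.Barriers.CriticalPhenomena.TimarHeavySlabs
import HarnessLib

/-!
# Timár 2006, §5 on QUASI-TRANSITIVE graphs: the extreme edge ratio `δ` (Timár's `μ = δ⁻¹`),
# separation of weight slabs, and bounded climbs/descents from an expanding automorphism — PROVED

Barrier catalogue `Literature/Barriers/CriticalPhenomena/`; the foundational brick of the
quasi-transitive port of the tree's proof of Timár's Thm. 5.5 (`Timar2006_finiteLevelUnion`,
`TimarCriticalNonunimodular.lean`; Á. Timár, *Percolation on nonunimodular transitive graphs*,
Ann. Probab. 34 (2006) 2344–2364, §5). The tree's §5 files are written for TRANSITIVE graphs and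
use transitivity through exactly three devices: (a) `Δ = minNbrWeight G o`, the least weight ratio
along an edge, with `Δ w(x) ≤ w(y)` for `x ∼ y` ("Let `μ` be the maximum of `w(x)/w(y)`, where `x`
and `y` are adjacent", §5 — Timár's `μ` is `Δ⁻¹`); (b) *long edges* at every vertex, up and down
(a neighbour of weight exactly `Δ^{∓1} w(x)`), used in the insertion-tolerance surgeries of
Lemma 5.2; (c) the Mass-Transport Principle at one base vertex. On a quasi-transitive graph:

* (a) survives: `minEdgeRatio G := inf_{x ∼ y} w_x(y)` takes finitely many values (finitely many
  edge orbits), so `0 < δ` (`minEdgeRatio_ne_zero`), `δ < 1` on a nonunimodular graph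
  (`minEdgeRatio_lt_one`, an edge joining two levels exists, `exists_adj_isAbove_of_not_isGraphUnimodular`),
  and `δ w(x) ≤ w(y)` along every edge (`minEdgeRatio_mul_autWeight_le`); hence weight slabs
  `{a < w ≤ b}` with `a ≤ δ b` separate (`forall_lt_autWeight_of_disjoint_weightSlab'`,
  `forall_autWeight_le_of_disjoint_weightSlab'`, closed-set forms);
* (b) is replaced by **bounded climbs and descents**: a nonunimodular graph has an automorphism
  `γ` multiplying all weights by a constant `c = w(γ o) > 1` (`exists_one_lt_autWeight_map`), and
  by quasi-transitivity walks of bounded length from every vertex `v` to a vertex of weight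
  `c · w(v)` (`exists_climb`) and to a vertex of weight `c⁻¹ · w(v)` (`exists_descent`);
* (c) is replaced by the MTP summed over orbit representatives (`NonunimodularMTPQuasiTransitive.lean`),
  in the later bricks.

## References

* Á. Timár, Ann. Probab. 34 (2006) 2344–2364 (arXiv:math/0702875), §5 (first paragraph: `μ`;
  slabs and their separating property), §2 (levels, weights). [Timar2006]
* T. Hutchcroft, C. R. Math. Acad. Sci. Paris 354 (2016) 944–947, §2 (Timár's theorem in the
  quasi-transitive setting). [Hutchcroft2016]
* R. Lyons, Y. Peres, *Probability on Trees and Networks*, CUP 2016, §8.2 (Thm. 8.10, the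
  cocycle of the weights; Exercise 8.6). [LyonsPeres2016]
-/

noncomputable section

namespace Literature.Barriers.CriticalPhenomena

open Literature.Probability.Percolation SimpleGraph
open scoped _root_.ENNReal

variable {V : Type*}

/-! ### The extreme edge ratio -/

/-- **The least weight ratio along an edge**, `δ := inf_{x ∼ y} w_x(y)` (`w_x(y) = w_o(y)/w_o(x)`,
independent of `o`); Timár's "`μ` := the maximum of `w(x)/w(y)`, where `x` and `y` are adjacent"
is `δ⁻¹`. On a transitive graph this is `minNbrWeight G o`. [cite: Timar2006, §5 (first paragraph: μ)] -/
def minEdgeRatio (G : SimpleGraph V) : ℝ≥0∞ :=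
  ⨅ p : {p : V × V // G.Adj p.1 p.2}, autWeight G p.1.1 p.1.2

section EdgeRatio

variable {G : SimpleGraph V} [G.LocallyFinite]

/-- **Along an edge the weight drops by at most the factor `δ`**: `δ · w(x) ≤ w(y)` for `x ∼ y`.
[cite: Timar2006, §5 (first paragraph: μ)] -/
theorem minEdgeRatio_mul_autWeight_le (hconn : G.Connected) (o : V) {x y : V} (hxy : G.Adj x y) :
    minEdgeRatio G * autWeight G o x ≤ autWeight G o y := by
  have h : minEdgeRatio G ≤ autWeight G x y := iInf_le _ (⟨(x, y), hxy⟩ : {p : V × V // G.Adj p.1 p.2})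
  calc minEdgeRatio G * autWeight G o x ≤ autWeight G x y * autWeight G o x := mul_le_mul' h le_rfl
    _ = autWeight G o y := autWeight_base_mul G hconn o x y

/-- Symmetric form: `δ · w(y) ≤ w(x)` for `x ∼ y`. [cite: Timar2006, §5 (first paragraph: μ)] -/
theorem minEdgeRatio_mul_autWeight_le' (hconn : G.Connected) (o : V) {x y : V} (hxy : G.Adj x y) :
    minEdgeRatio G * autWeight G o y ≤ autWeight G o x :=
  minEdgeRatio_mul_autWeight_le hconn o hxy.symm

/-- **`δ < 1` on a connected, locally finite, nonunimodular graph** (some edge joins a vertex to a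
vertex below it, Lyons–Peres 2016, Exercise 8.6). [cite: LyonsPeres2016, §8.2 (Exercise 8.6)] -/
theorem minEdgeRatio_lt_one (hconn : G.Connected) (hU : ¬ IsGraphUnimodular G) : minEdgeRatio G < 1 := by
  obtain ⟨x, y, hxy, habove⟩ := exists_adj_isAbove_of_not_isGraphUnimodular hconn hU
  rw [isAbove_iff_autWeight_lt G hconn x, autWeight_self G hconn x] at habove
  exact lt_of_le_of_lt (iInf_le _ (⟨(x, y), hxy⟩ : {p : V × V // G.Adj p.1 p.2})) habove

/-- `δ ≠ ⊤` on a nonunimodular graph. [folklore] -/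
theorem minEdgeRatio_ne_top (hconn : G.Connected) (hU : ¬ IsGraphUnimodular G) : minEdgeRatio G ≠ ⊤ :=
  ne_top_of_lt (minEdgeRatio_lt_one hconn hU)

/-- **`δ ≠ 0` on a connected, locally finite, quasi-transitive graph**: every edge is the image
under an automorphism of one of the finitely many edges at a finite set of representatives, and
`w_x(y)` is invariant. [cite: Timar2006, §5 (μ is a maximum)] -/
theorem minEdgeRatio_ne_zero (hconn : G.Connected) (hqt : IsQuasiTransitive G) : minEdgeRatio G ≠ 0 := by
  classical
  obtain ⟨S₀, hS₀⟩ := hqt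
  -- the finitely many values at the representatives
  set T : Finset ℝ≥0∞ := S₀.biUnion fun s => (G.neighborFinset s).image fun n => autWeight G s n with hT
  have hval : ∀ p : {p : V × V // G.Adj p.1 p.2}, autWeight G p.1.1 p.1.2 ∈ T := by
    rintro ⟨⟨x, y⟩, hxy⟩
    obtain ⟨γ, hγ⟩ := hS₀ x
    have hadj : G.Adj (γ x) (γ y) := (γ.map_rel_iff').2 hxy
    rw [hT, Finset.mem_biUnion]
    refine ⟨γ x, hγ, Finset.mem_image.2 ⟨γ y, (G.mem_neighborFinset _ _).2 hadj, ?_⟩⟩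
    exact autWeight_map_map γ x y
  rw [minEdgeRatio]
  by_cases hP : Nonempty {p : V × V // G.Adj p.1 p.2}
  · obtain ⟨p₀⟩ := hP
    have hne : T.Nonempty := ⟨_, hval p₀⟩
    have hpos : 0 < T.inf' hne id := by
      obtain ⟨t, ht, hteq⟩ := Finset.exists_mem_eq_inf' hne id
      rw [hteq]
      rw [hT, Finset.mem_biUnion] at ht
      obtain ⟨s, -, ht⟩ := ht
      rw [Finset.mem_image] at ht
      obtain ⟨n, -, rfl⟩ := ht
      exact pos_iff_ne_zero.2 (autWeight_ne_zero G hconn s n)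
    exact ne_of_gt (lt_of_lt_of_le hpos (le_iInf fun p => Finset.inf'_le id (hval p)))
  · rw [not_nonempty_iff] at hP
    rw [iInf_of_empty]
    exact ENNReal.top_ne_zero

end EdgeRatio

/-! ### Separation of weight slabs (closed-set forms, configurations on `E(G)`) -/

section Separation

variable {G : SimpleGraph V} [G.LocallyFinite]

/-- **A connected open piece avoiding a slab `{a < w ≤ b}` with `a ≤ δ b` and containing a vertex
above it lies entirely above it.** [cite: Timar2006, §5 ("a slab separates the levels below it from the levels above it")] -/
theorem forall_lt_autWeight_of_disjoint_weightSlab' (hconn : G.Connected) {o : V} {a b : ℝ≥0∞}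
    (hab : a ≤ minEdgeRatio G * b) {ω : BondConfig V} (hω : ω ⊆ G.edgeSet) {z : V}
    (hz : b < autWeight G o z) (hdisj : Disjoint (openCluster ω z) (weightSlab G o a b)) :
    ∀ y ∈ openCluster ω z, b < autWeight G o y := by
  have hbT : b ≠ ⊤ := ne_top_of_lt hz
  refine openCluster_subset_of_forall_mem' (S := {y | b < autWeight G o y}) hz fun u c hu huS huc hne => ?_
  have hadj : G.Adj u c := by have := hω huc; rwa [SimpleGraph.mem_edgeSet] at this
  have hc : c ∈ openCluster ω z := mem_openCluster_of_adj hu huc hne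
  have hcL : c ∉ weightSlab G o a b := Set.disjoint_left.1 hdisj hc
  change b < autWeight G o c
  by_contra hcb
  rw [not_lt] at hcb
  have hca : autWeight G o c ≤ a := by
    by_contra h
    exact hcL ⟨not_le.1 h, hcb⟩
  -- `a ≤ δ b < δ w(u) ≤ w(c) ≤ a` (if `δ = 0` then `a = 0 < w(c)` contradicts nothing… but `w(c) ≤ a = 0` does)
  by_cases hδ : minEdgeRatio G = 0
  · rw [hδ, zero_mul, nonpos_iff_eq_zero] at hab
    rw [hab, nonpos_iff_eq_zero] at hca
    exact autWeight_ne_zero G hconn o c hca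
  have hδT : minEdgeRatio G ≠ ⊤ := by
    intro hT
    have h := minEdgeRatio_mul_autWeight_le hconn o hadj
    rw [hT, ENNReal.top_mul (autWeight_ne_zero G hconn o u), top_le_iff] at h
    exact autWeight_ne_top G hconn o c h
  have h1 : minEdgeRatio G * b < minEdgeRatio G * autWeight G o u := ENNReal.mul_lt_mul_right hδ hδT huS
  have h2 := minEdgeRatio_mul_autWeight_le hconn o hadj
  exact absurd (hab.trans_lt (h1.trans_le (h2.trans hca))) (lt_irrefl a)

/-- **… and one containing a vertex of weight `≤ a` lies entirely at weight `≤ a`.**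
[cite: Timar2006, §5 ("a slab separates the levels below it from the levels above it")] -/
theorem forall_autWeight_le_of_disjoint_weightSlab' (hconn : G.Connected) (hU : ¬ IsGraphUnimodular G)
    {o : V} {a b : ℝ≥0∞} (hab : a ≤ minEdgeRatio G * b) {ω : BondConfig V} (hω : ω ⊆ G.edgeSet)
    {z : V} (hz : autWeight G o z ≤ a) (hdisj : Disjoint (openCluster ω z) (weightSlab G o a b)) :
    ∀ y ∈ openCluster ω z, autWeight G o y ≤ a := by
  refine openCluster_subset_of_forall_mem' (S := {y | autWeight G o y ≤ a}) hz fun u c hu huS huc hne => ?_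
  have hadj : G.Adj u c := by have := hω huc; rwa [SimpleGraph.mem_edgeSet] at this
  have hc : c ∈ openCluster ω z := mem_openCluster_of_adj hu huc hne
  have hcL : c ∉ weightSlab G o a b := Set.disjoint_left.1 hdisj hc
  change autWeight G o c ≤ a
  by_contra hca
  rw [not_le] at hca
  have hcb : b < autWeight G o c := by
    by_contra h
    exact hcL ⟨hca, not_lt.1 h⟩
  by_cases hδ : minEdgeRatio G = 0
  · -- `δ = 0`: then `a = 0` and `w(u) ≤ 0` is absurd
    rw [hδ, zero_mul, nonpos_iff_eq_zero] at hab
    have huS' : autWeight G o u ≤ a := huS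
    rw [hab, nonpos_iff_eq_zero] at huS'
    exact autWeight_ne_zero G hconn o u huS'
  have h1 : minEdgeRatio G * b < minEdgeRatio G * autWeight G o c :=
    ENNReal.mul_lt_mul_right hδ (minEdgeRatio_ne_top hconn hU) hcb
  have h2 := minEdgeRatio_mul_autWeight_le' hconn o hadj
  exact absurd ((h2.trans huS).trans hab) (not_le.2 h1)

end Separation

/-! ### An expanding automorphism; bounded climbs and descents -/

section Climb

variable {G : SimpleGraph V} [G.LocallyFinite]

/-- **A nonunimodular graph has an automorphism multiplying all weights by a constant `> 1`**
(`w(γ v) = w(γ o) w(v)`, `autWeight_map_eq_mul`, with `w(γ o) > 1`).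
[cite: Timar2006, §5 ("any automorphism … acts on the weights … by multiplying them with a constant")] -/
theorem exists_one_lt_autWeight_map (hconn : G.Connected) (hU : ¬ IsGraphUnimodular G) (o : V) :
    ∃ γ : G ≃g G, 1 < autWeight G o (γ o) := by
  obtain ⟨a, b, ⟨γ₀, rfl⟩, habove⟩ := exists_isAbove_of_not_isGraphUnimodular hU
  rw [isAbove_iff_autWeight_lt G hconn o] at habove
  -- `w(γ₀ a) < w(a)`: `γ₀` contracts by `w(γ₀ o) < 1`, so `γ₀⁻¹` expands
  refine ⟨γ₀.symm, ?_⟩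
  have h1 : autWeight G o (γ₀ a) = autWeight G o (γ₀ o) * autWeight G o a := autWeight_map_eq_mul G hconn γ₀ o a
  have hlt : autWeight G o (γ₀ o) < 1 := by
    rw [h1] at habove
    have : autWeight G o (γ₀ o) * autWeight G o a < 1 * autWeight G o a := by rwa [one_mul]
    exact lt_of_mul_lt_mul_right' this
  -- `w(γ₀⁻¹ o) w(γ₀ o) = 1`
  have h2 : autWeight G o (γ₀.symm o) * autWeight G o (γ₀ o) = 1 := by
    have h := autWeight_map_eq_mul G hconn γ₀ o (γ₀.symm o)
    rw [γ₀.apply_symm_apply, autWeight_self G hconn o] at h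
    rw [mul_comm]; exact h.symm
  have h0 : autWeight G o (γ₀ o) ≠ 0 := autWeight_ne_zero G hconn o _
  have hT : autWeight G o (γ₀ o) ≠ ⊤ := autWeight_ne_top G hconn o _
  by_contra hle
  rw [not_lt] at hle
  have : autWeight G o (γ₀.symm o) * autWeight G o (γ₀ o) < 1 * 1 :=
    calc autWeight G o (γ₀.symm o) * autWeight G o (γ₀ o) ≤ 1 * autWeight G o (γ₀ o) := mul_le_mul' hle le_rfl
      _ < 1 * 1 := ENNReal.mul_lt_mul_right one_ne_zero ENNReal.one_ne_top hlt
  rw [h2, mul_one] at this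
  exact lt_irrefl _ this

/-- Conjugating by `δ` does not change the expansion factor: `w(δ⁻¹ γ δ v) = w(γ o) w(v)`.
[cite: LyonsPeres2016, Thm. 8.10 (the cocycle of the weights)] -/
theorem autWeight_conj_apply (hconn : G.Connected) (γ δ : G ≃g G) (o v : V) :
    autWeight G o (δ.symm (γ (δ v))) = autWeight G o (γ o) * autWeight G o v := by
  have h1 := autWeight_map_mul G hconn δ.symm o (γ (δ v)) (δ v)
  rw [δ.symm_apply_apply, autWeight_map_eq_mul G hconn γ o (δ v)] at h1
  -- `w(δ⁻¹γδv) w(δv) = (w(γo) w(v)) w(δv)`… precisely `w(u) w(δ v) = w(v) (w(γ o) w(δ v))`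
  have h0 := autWeight_ne_zero G hconn o (δ v)
  have hT := autWeight_ne_top G hconn o (δ v)
  have : autWeight G o (δ.symm (γ (δ v))) * autWeight G o (δ v) =
      (autWeight G o (γ o) * autWeight G o v) * autWeight G o (δ v) := by rw [h1]; ring
  exact (ENNReal.mul_left_inj h0 hT).1 this

/-- **Bounded climbs**: on a connected, locally finite, quasi-transitive, nonunimodular graph
there are `c > 1` (finite) and `R₁` such that from EVERY vertex `v` some walk of length `≤ R₁`
leads to a vertex of weight `c · w(v)`. [cite: Timar2006, Lemma 5.2 (proof: a vertex above the cluster; transitive case via long edges)] -/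
theorem exists_climb (hconn : G.Connected) (hqt : IsQuasiTransitive G) (hU : ¬ IsGraphUnimodular G)
    (o : V) :
    ∃ c : ℝ≥0∞, 1 < c ∧ c ≠ ⊤ ∧ ∃ R₁ : ℕ, ∀ v : V, ∃ n ≤ R₁, ∃ f : ℕ → V, f 0 = v ∧
      (∀ i < n, G.Adj (f i) (f (i + 1))) ∧ autWeight G o (f n) = c * autWeight G o v := by
  classical
  obtain ⟨S₀, hS₀⟩ := hqt
  obtain ⟨γ, hγ⟩ := exists_one_lt_autWeight_map hconn hU o
  refine ⟨autWeight G o (γ o), hγ, autWeight_ne_top G hconn o _, ?_⟩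
  have hwalk : ∀ s : V, Nonempty (G.Walk s (γ s)) := fun s => hconn.preconnected s (γ s)
  set W : ∀ s : V, G.Walk s (γ s) := fun s => (hwalk s).some with hW
  refine ⟨S₀.sup fun s => (W s).length, fun v => ?_⟩
  obtain ⟨δ, hδ⟩ := hS₀ v
  -- transport the walk `δ v → γ (δ v)` by `δ⁻¹`
  set p : G.Walk (δ.symm (δ v)) (δ.symm (γ (δ v))) := (W (δ v)).map δ.symm.toHom with hp
  refine ⟨(W (δ v)).length, Finset.le_sup (f := fun s => (W s).length) hδ, fun i => p.getVert i, ?_, ?_, ?_⟩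
  · show p.getVert 0 = v
    rw [SimpleGraph.Walk.getVert_zero, δ.symm_apply_apply]
  · intro i hi
    have hlen : p.length = (W (δ v)).length := SimpleGraph.Walk.length_map _ _
    exact p.adj_getVert_succ (by rw [hlen]; exact hi)
  · have hlen : p.length = (W (δ v)).length := SimpleGraph.Walk.length_map _ _
    show autWeight G o (p.getVert (W (δ v)).length) = _
    rw [← hlen, SimpleGraph.Walk.getVert_length]
    exact autWeight_conj_apply hconn γ δ o v

/-- **Bounded descents**: likewise walks of length `≤ R₁` to a vertex of weight `c⁻¹ · w(v)`
(with the same `c > 1`), from the inverse automorphism. [cite: Timar2006, Lemma 5.2 (proof: a vertex below the cluster)] -/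
theorem exists_descent (hconn : G.Connected) (hqt : IsQuasiTransitive G) (hU : ¬ IsGraphUnimodular G)
    (o : V) :
    ∃ c : ℝ≥0∞, 1 < c ∧ c ≠ ⊤ ∧ ∃ R₁ : ℕ, ∀ v : V, ∃ n ≤ R₁, ∃ f : ℕ → V, f 0 = v ∧
      (∀ i < n, G.Adj (f i) (f (i + 1))) ∧ c * autWeight G o (f n) = autWeight G o v := by
  classical
  obtain ⟨S₀, hS₀⟩ := hqt
  obtain ⟨γ, hγ⟩ := exists_one_lt_autWeight_map hconn hU o
  set c := autWeight G o (γ o) with hc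
  have hc0 : c ≠ 0 := autWeight_ne_zero G hconn o _
  have hcT : c ≠ ⊤ := autWeight_ne_top G hconn o _
  refine ⟨c, hγ, hcT, ?_⟩
  have hwalk : ∀ s : V, Nonempty (G.Walk s (γ.symm s)) := fun s => hconn.preconnected s (γ.symm s)
  set W : ∀ s : V, G.Walk s (γ.symm s) := fun s => (hwalk s).some with hW
  refine ⟨S₀.sup fun s => (W s).length, fun v => ?_⟩
  obtain ⟨δ, hδ⟩ := hS₀ v
  set p : G.Walk (δ.symm (δ v)) (δ.symm (γ.symm (δ v))) := (W (δ v)).map δ.symm.toHom with hp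
  refine ⟨(W (δ v)).length, Finset.le_sup (f := fun s => (W s).length) hδ, fun i => p.getVert i, ?_, ?_, ?_⟩
  · show p.getVert 0 = v
    rw [SimpleGraph.Walk.getVert_zero, δ.symm_apply_apply]
  · intro i hi
    have hlen : p.length = (W (δ v)).length := SimpleGraph.Walk.length_map _ _
    exact p.adj_getVert_succ (by rw [hlen]; exact hi)
  · have hlen : p.length = (W (δ v)).length := SimpleGraph.Walk.length_map _ _
    show c * autWeight G o (p.getVert (W (δ v)).length) = _
    rw [← hlen, SimpleGraph.Walk.getVert_length]
    -- `w(δ⁻¹ γ⁻¹ δ v) = w(γ⁻¹ o) w(v)` and `c w(γ⁻¹ o) = 1`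
    rw [autWeight_conj_apply hconn γ.symm δ o v, ← mul_assoc]
    have h2 : c * autWeight G o (γ.symm o) = 1 := by
      have h := autWeight_map_eq_mul G hconn γ o (γ.symm o)
      rw [γ.apply_symm_apply, autWeight_self G hconn o] at h
      exact h.symm
    rw [h2, one_mul]

end Climb

end Literature.Barriers.CriticalPhenomena

end
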